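import Summits.ResolutionOfSingularities.ResolutionOfSingularities.Theorems.CleanCoversCoverResolutionSplit
import Summits.ResolutionOfSingularities.ResolutionOfSingularities.Theorems.WeightedInvariantWeightedThesisNormalizationIso
import Literature.AlgebraicGeometry.Resolution.SurfaceResolutionReduction
import Literature.AlgebraicGeometry.Resolution.PrincipalizationToResolution
import HarnessLib

/-!
# Crux `CleanCovers.CoverResolution` (stmt-ResolutionOfSingularities-15104), line `strategy-split`
# (v2): CERTIFICATE `boundaryLocalResolution_of_normal` — the open stub L reduces to NORMAL covers

Route `ResolutionOfSingularities/CleanCovers`. A *Kedlaya cover* is an integral scheme `X` with a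
finite surjective `f : X → ℙⁿ_k` (`k` perfect of characteristic `p`) which is étale over the chart
`A := D₊(xₙ)`. The line's open stub **L** (`stub_boundaryLocalResolution`) asks: around every point
`h ∉ A` of `ℙⁿ_k` there is an open `B ∋ h` with `f⁻¹(B)` resolvable (`Scheme.HasResolution`). The
route's engine (cleaning of wild ramification on the base) works with NORMAL covers, so this file
PROVES the reduction `LNORMAL → L`: if L holds for all Kedlaya covers all of whose local rings are
integrally closed, then it holds for all Kedlaya covers.

Proof. Let `ν := normalizationι X : X^ν → X` be the normalisation (finite by E. Noether,
`isFinite_normalizationι … NoetherFiniteIntegralClosure_holds`; birational,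
`isBirational_normalizationι`; `X^ν` integral with integrally closed stalks,
`isIntegrallyClosed_stalk_normalization`). (i) `f⁻¹(A)` is étale over the regular chart `A`
(`smooth_isSeparated_quasiCompact_isRegular_opens_projectiveSpace`), hence regular
(`Scheme.IsRegular.of_smooth`), so `f⁻¹(A) ⊆ Reg X` and `ν` is an isomorphism over `f⁻¹(A)`
(`WeightedThesis.KunzTower.isIso_normalizationι_morphismRestrict_of_subset_regularLocus`); thus
`(ν ≫ f) ∣_ A = (ν ∣_ f⁻¹A) ≫ (f ∣_ A)` (`morphismRestrict_comp`) is étale. (ii) `ν ≫ f` is finite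
and surjective (`ν` is closed and dominant). (iii) LNORMAL applied to `(X^ν, ν ≫ f)` at `h` gives
`B ∋ h` with `(ν ≫ f)⁻¹(B) = ν⁻¹(f⁻¹(B))` resolvable. (iv) The resolution descends along the finite
(hence proper) birational `ν ∣_ f⁻¹(B)` (`IsBirational.morphismRestrict`,
`Scheme.HasResolution.of_isBirational`). No named fact is taken as a hypothesis; E. Noether's
finiteness theorem is the tree's THEOREM `NoetherFiniteIntegralClosure_holds`.
-/

set_option linter.dupNamespace false -- mandated namespace of this single-conjunct summit

noncomputable section

namespace Summit.ResolutionOfSingularities.ResolutionOfSingularities.Theorems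

open CategoryTheory AlgebraicGeometry TopologicalSpace
open Literature.AlgebraicGeometry.Resolution

/-! ## Two bookkeeping lemmas on the normalisation -/

/-- The normalisation morphism `X^ν → X` of an integral scheme is surjective: it is integral,
hence (universally) closed, and dominant. [folklore] -/
theorem surjective_normalizationι_base (X : Scheme.{0}) [IsIntegral X] :
    Function.Surjective (normalizationι X).base :=
  (surjective_of_isDominant_of_isClosed_range (normalizationι X)
    (normalizationι X).isClosedMap.isClosed_range).surj

/-- The points of an open subscheme `U ⊆ X` which is regular (as a scheme) lie in the regular
locus of `X`: the stalks of `U` are those of `X` (`U.ι.stalkMap` is an isomorphism). [folklore] -/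
theorem coe_subset_regularLocus_of_isRegular {X : Scheme.{0}} (U : X.Opens)
    (hU : Scheme.IsRegular (U : Scheme.{0})) : (U : Set X) ⊆ Scheme.regularLocus X := by
  intro x hx
  haveI := hU ⟨x, hx⟩
  exact IsRegularLocalRing.of_ringEquiv (asIso (U.ι.stalkMap ⟨x, hx⟩)).commRingCatIsoToRingEquiv.symm

/-! ## The certificate: L for normal Kedlaya covers implies L -/

/-- **Certificate `boundaryLocalResolution_of_normal` (line `strategy-split` v2): the open stub L
(local resolution of Kedlaya covers along the hyperplane at infinity) reduces to NORMAL covers.**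
If, for every Kedlaya cover `f : X → ℙⁿ_k` (integral `X`, `f` finite surjective, étale over
`D₊(xₙ)`, `k` perfect of characteristic `p`) all of whose local rings are integrally closed, every
point `h ∉ D₊(xₙ)` has an open `B ∋ h` with `f⁻¹(B)` resolvable, then the same holds for every
Kedlaya cover: pass to the normalisation `ν : X^ν → X` (finite by E. Noether, birational, normal;
an isomorphism over the regular open `f⁻¹(D₊(xₙ))`, so `ν ≫ f` is again a Kedlaya cover) and
descend the resolution of `ν⁻¹(f⁻¹(B))` along the proper birational `ν ∣_ f⁻¹(B)`. [folklore] -/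
theorem boundaryLocalResolution_of_normal : (∀ p : ℕ, p.Prime → ∀ (k : Type) [Field k] [CharP k p] [PerfectField k] (n : ℕ) (X : AlgebraicGeometry.Scheme.{0}) (f : X ⟶ (Literature.AlgebraicGeometry.Motives.projectiveSpace n k).left), AlgebraicGeometry.IsIntegral X → AlgebraicGeometry.IsFinite f → Function.Surjective f.base → (letI := MvPolynomial.gradedAlgebra (σ := Fin (n + 1)) (R := k); AlgebraicGeometry.Etale (f ∣_ (AlgebraicGeometry.Proj.basicOpen (MvPolynomial.homogeneousSubmodule (Fin (n + 1)) k) (MvPolynomial.X (Fin.last n))))) → (∀ x : X, IsIntegrallyClosed (X.presheaf.stalk x)) → ∀ h : (Literature.AlgebraicGeometry.Motives.projectiveSpace n k).left, (letI := MvPolynomial.gradedAlgebra (σ := Fin (n + 1)) (R := k); h ∉ AlgebraicGeometry.Proj.basicOpen (MvPolynomial.homogeneousSubmodule (Fin (n + 1)) k) (MvPolynomial.X (Fin.last n))) → ∃ B : (Literature.AlgebraicGeometry.Motives.projectiveSpace n k).left.Opens, h ∈ B ∧ Literature.AlgebraicGeometry.Resolution.Scheme.HasResolution ((f ⁻¹ᵁ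 B : X.Opens) : AlgebraicGeometry.Scheme.{0})) → (∀ p : ℕ, p.Prime → ∀ (k : Type) [Field k] [CharP k p] [PerfectField k] (n : ℕ) (X : AlgebraicGeometry.Scheme.{0}) (f : X ⟶ (Literature.AlgebraicGeometry.Motives.projectiveSpace n k).left), AlgebraicGeometry.IsIntegral X → AlgebraicGeometry.IsFinite f → Function.Surjective f.base → (letI := MvPolynomial.gradedAlgebra (σ := Fin (n + 1)) (R := k); AlgebraicGeometry.Etale (f ∣_ (AlgebraicGeometry.Proj.basicOpen (MvPolynomial.homogeneousSubmodule (Fin (n + 1)) k) (MvPolynomial.X (Fin.last n))))) → ∀ h : (Literature.AlgebraicGeometry.Motives.projectiveSpace n k).left, (letI := MvPolynomial.gradedAlgebra (σ := Fin (n + 1)) (R := k); h ∉ AlgebraicGeometry.Proj.basicOpen (MvPolynomial.homogeneousSubmodule (Fin (n + 1)) k) (MvPolynomial.X (Fin.last n))) → ∃ B : (Literature.AlgebraicGeometry.Motives.projectiveSpace n k).left.Opens, h ∈ B ∧ Literature.AlgebraicGeometry.Resolution.Scheme.HasResolution ((f ⁻¹ᵁ B : X.Opens) : AlgebraicGeometry.Scheme.{0}))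 := by
  intro hLn p hp k _ _ _ n X f hint hfin hsurj het h hh
  letI := MvPolynomial.gradedAlgebra (σ := Fin (n + 1)) (R := k)
  haveI := hfin
  haveI := hint
  -- the chart `A = D_+(x_n) ⊆ P^n_k`
  set A : (Literature.AlgebraicGeometry.Motives.projectiveSpace n k).left.Opens :=
    AlgebraicGeometry.Proj.basicOpen (MvPolynomial.homogeneousSubmodule (Fin (n + 1)) k)
      (MvPolynomial.X (Fin.last n))
  haveI hAet : Etale (f ∣_ A) := het
  -- Noetherian bookkeeping and the `k`-structure of `X`
  haveI : IsProper (Literature.AlgebraicGeometry.Motives.projectiveSpace n k).hom :=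
    Literature.AlgebraicGeometry.Motives.isProper_projectiveSpace n k
  haveI hPN : IsLocallyNoetherian (Literature.AlgebraicGeometry.Motives.projectiveSpace n k).left :=
    LocallyOfFiniteType.isLocallyNoetherian (Literature.AlgebraicGeometry.Motives.projectiveSpace n k).hom
  let g : X ⟶ Spec (.of k) := f ≫ (Literature.AlgebraicGeometry.Motives.projectiveSpace n k).hom
  haveI : LocallyOfFiniteType g := inferInstance
  -- the normalisation `ν : X^ν → X`: finite (E. Noether), surjective
  haveI hνfin : IsFinite (normalizationι X) :=
    isFinite_normalizationι X NoetherFiniteIntegralClosure_holds g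
  have hνsurj : Function.Surjective (normalizationι X).base := surjective_normalizationι_base X
  -- (i) `f ⁻¹ A` is étale over the regular `A`, hence regular, so `ν` is an iso over it
  have hAreg : Scheme.IsRegular (A : Scheme.{0}) :=
    (smooth_isSeparated_quasiCompact_isRegular_opens_projectiveSpace n A).2.2.2
  have hfAreg : Scheme.IsRegular ((f ⁻¹ᵁ A : X.Opens) : Scheme.{0}) :=
    Scheme.IsRegular.of_smooth (f ∣_ A) hAreg
  haveI hiso : IsIso (normalizationι X ∣_ f ⁻¹ᵁ A) :=
    WeightedThesis.KunzTower.isIso_normalizationι_morphismRestrict_of_subset_regularLocus X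
      (f ⁻¹ᵁ A) (coe_subset_regularLocus_of_isRegular (f ⁻¹ᵁ A) hfAreg)
  have het' : Etale ((normalizationι X ≫ f) ∣_ A) := by
    rw [morphismRestrict_comp]
    haveI h1 : IsOpenImmersion (normalizationι X ∣_ f ⁻¹ᵁ A) := IsOpenImmersion.of_isIso _
    haveI h2 : Etale (normalizationι X ∣_ f ⁻¹ᵁ A) := inferInstance
    haveI h3 : Etale (f ∣_ A) := hAet
    exact Etale.etale_comp (normalizationι X ∣_ f ⁻¹ᵁ A) (f ∣_ A)
  -- (ii) `ν ≫ f` is finite and surjective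
  have hsurj' : Function.Surjective (normalizationι X ≫ f).base := by
    rw [Scheme.Hom.comp_base, TopCat.coe_comp]
    exact hsurj.comp hνsurj
  -- (iii) apply LNORMAL to the normal Kedlaya cover `(X^ν, ν ≫ f)` at `h`
  obtain ⟨B, hhB, hres⟩ := hLn p hp k n (normalization X) (normalizationι X ≫ f) inferInstance
    inferInstance hsurj' het' (isIntegrallyClosed_stalk_normalization X) h hh
  -- (iv) descend along the finite birational `ν ∣_ f ⁻¹ B : ν ⁻¹ (f ⁻¹ B) → f ⁻¹ B`
  exact ⟨B, hhB, Scheme.HasResolution.of_isBirational (normalizationι X ∣_ f ⁻¹ᵁ B)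
    ((isBirational_normalizationι X g).morphismRestrict (f ⁻¹ᵁ B)) hres⟩

end Summit.ResolutionOfSingularities.ResolutionOfSingularities.Theorems

end
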